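import Literature.MathematicalPhysics.QuantumFieldTheory.Balaban1983to89.B16NodeKnitSocket
import Literature.MathematicalPhysics.QuantumFieldTheory.Balaban1983to89.B14NodeKnitRepTower

/-!
# `Balaban1983to89.B16NodeKnitRepTower` — YM-DAG node N13 · [Balaban1989LargeFieldII] CMP **122** (1989) 355–392, Theorem 1 p. 355 + (0.1), Cor. 3
# pp. 387 ∕ 391: the N13 knit OVER A REPRESENTED TOWER (NODE 00 Stage ₉ shape, pub-ymgap chair R437) — N13's two products in the currency print
# manipulates: (R₉) the 𝐑-step TRANSPORTS THE LAWS at representation level (`LawsT r → Laws (Rstep r)`), read into the world's `rOperation` leaf through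
# the along-the-tower pin; (UV₉) Cor. 3 = the POINTWISE two-sided bound (0.1) on the EXPLICIT represented densities `ρ_k = eval rep_k` of law-abiding
# levels; the density-level bridge `ROpLeaf V ↔ (laws transported along the tower)` under the along-pins of the 𝐑-carriers; the N11 ∧ N13 junction on
# one tower BY NAME, up to the run's (B) and the pin `B16.EndStatementBPrinted w.C`

statement-level bookkeeping over published theorems with citation tags; kernel-checked compositions of tree theorems;
nothing here is a claim about the Yang–Mills mass gap.

CITATION HEADER (lean-in-tree rule).  Source: T. Bałaban, *Large field renormalization. II. Localization, exponentiation, and bounds for the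
𝐑 operation*, Commun. Math. Phys. **122**, 355–392 (1989), doi:10.1007/bf01238433 [Balaban1989LargeFieldII] (cell paper B16 = «[V]»), with
[Balaban1988Convergent] («[III]»: the assumed 𝐑 of p. 244, the representation (2.18) p. 257, Thm 1 p. 262, Cor. 3 (2.50) p. 264) and
[Balaban1989LargeFieldI] («[IV]»: the represented density (0.2) and the steps (0.3)–(0.4) p. 176).  Seat `pub-ymgap-dag-n13-a` (YM-PLAN Track A, HUMAN
RULING D-0062: the KNIT-BY-NAME seat of node N13), module 8 of the seat.  BY NAME and UNCHANGED: `…B16NodeKnitSocket` (module 7: `uvSlot_of_direct`,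
`uvSlot_of_dominated`), `…B16NodeKnitRecord5` (module 5: `b16_main_of_rOperation_of_uvSlot`), `…B14NodeKnitRepTower` (seat dag-n11-a: `b14_main_of_repTower`,
`b14_main_of_repTower_eval`, `densitiesDescribed_iff_laws`), `…DagBinding` (`leavesP`, `WorldP`, `PrintedCarriers14R`, `ROpLeaf`, `rOpLeaf_iff`,
`endStatementBPrinted_of_worldsP`), `…B16` (`UVIneq`, `EndStatementBPrinted`), `…B14Cor3` (`inInterval_of_le`), `…Dag` (`B14_main` :224, `B16_main` :253,
`UVStability4D` :261).

WHY THIS FILE (pub-ymgap chair R437, 2026-08-25, adopting seat node00-def's `STAGE6-9-DESIGN-g28.md` §2; seat dag-n13-b's kernel certificate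
`probe_Stage7_pointwise`; seat dag-n11-a's sibling `B14NodeKnitRepTower`).  NODE 00 re-bases its record at Stage ₉ on the REPRESENTED TOWER: per run,
representation data `rep_k` ([III] (2.18) *«ρ_k can be represented as Σ … χ_k(Ω_k) 𝐓_k(…) exp A_k»*; [IV] (0.2)), the densities of record `ρ_k := eval rep_k`
(explicit functions, pointwise meaningful — no `rnDeriv` version), the two steps `Tstep` ([III] §3, the Theorem of p. 245) and `Rstep` ([IV] (0.3)∕(1.100); [V]
§1) acting ON representations, `rep_{k+1} := Rstep (Tstep rep_k)`, the §2-form clause a property of the carried object («the laws»), and the 𝐑-carriers' spaces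
pinned ALONG THE TOWER (`S (k+1) ρ :↔ ρ = eval rep_{k+1} ∧ Laws rep_{k+1}`, the design's `S218`; `Scorr (k+1) ρ' :↔ ρ' = eval (Tstep rep_k) ∧ LawsT (Tstep
rep_k)`, the corresponding space of [III] p. 262 ∕ p. 279; the density operator `R` induced by `Rstep` on the record's own `Tρ_k`).  Seat dag-n11-a typed N11
over this shape GENERICALLY (its (𝐑) slot a hypothesis `rOperation → …`).  For N13 the leaf `rOperation` is a PRODUCT: what [V] proves for 𝐑 (Thm 1, pp.
356–391: the renormalised image 𝐑′𝐓ρ_k of a density in the corresponding space lies in the index-`(k+1)` space) reads, at representation level, `∀ r, LawsT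
k r → Laws (k+1) (Rstep k r)` — (R₉) —, and the world's leaf follows from it through the along-pin; and (0.1) ∕ Cor. 3 ([V] p. 387 *«This implies the
inequality (2.50) [III], hence Corollary 3.»*) reads: for every law-abiding level, the explicit function `eval rep_k` obeys the two-sided bound POINTWISE in
the configuration — (UV₉).  This module is that knit, GENERIC over the representation types, the two steps, the two law families and the evaluation
(so that NODE 00's `Record9` instantiates it by `rfl` ∕ `Iff.rfl` whatever its final field names; T and R NOT hard-wired), together with the density-level
bridge for the 𝐑-carriers `V : PrintedCarriers14R` the record will pin, and the junction with N11 on the same tower by name.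

WHAT THIS FILE PROVES (0 `sorry`, 0 `def`, standard axioms).
§1 World level, one run, generic tower: `lawsAlong_of_rstepLaw` ((R₉) ⇒ laws transported along the tower); `rOperation_of_repTower` (the leaf from (R₉) via the
   pin); `uvSlot_of_repTower` ∕ `_eval` ∕ `_dominated` (N13's Cor.-3 slot from (UV₉), in `UVIneq` currency, in explicit-`eval` currency, from dominated
   per-step constants given `χ_k ≥ 0`); **`b16_main_of_repTower`** (N13 at `(w, P)` from (R₉) + pin + (UV₉)); `b16_main_of_repTower_along` (weakest form);
   `b16_main_of_repTower_eval`; `b16_main_of_repTower_dominated`; locators `lawsAlong_of_b16_main` and `uvIneq_eval_of_b16_main` (what N13 SAYS at Stage ₉: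
   law transport along the tower, and (0.1) pointwise on `eval rep_k` — the vacuity audit A4 for N13 at ₉ in kernel form).
§2 Density level, the 𝐑-carriers: **`rOpLeaf_iff_lawsAlong`** (under the along-pins of `V.S`, `V.Scorr` and `V.R (eval rT_k) = eval rep_{k+1}`: `ROpLeaf V ↔ ∀ k <
   K, LawsT k rT_k → Laws (k+1) rep_{k+1}`); `rOpLeaf_of_lawsAlong` (one-directional pins suffice to PRODUCE the leaf); `rOpLeaf_of_rstepLaw` (from (R₉));
   `rOpLeaf_of_targetLaws` (A4: if the target laws hold outright — e.g. a law-free pin — the leaf is inhabited whatever 𝐑 does).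
§3 Junction with N11 on one tower, BY NAME: `nodes_N11_N13_of_repTower` (`Dag.B14_main ∧ Dag.B16_main` at `(w, P)` from (S0), (S1), (R₉), pin, (UV₉) — N11's
   (𝐑) hypothesis DISCHARGED by N13's (R₉)); `uvStability4D_of_repTower` (the run's (B) given N11's in-edge leaves, the small-field leaf and the flow step);
   `endStatementBPrinted_of_repTowers` (the pin `B16.EndStatementBPrinted w.C` from per-run towers, `DagBinding.endStatementBPrinted_of_worldsP`).

HONEST FRAMING.  A count-neutral SLOT landing (R429 (4)(i)): N13 is NOT discharged — (R₉) = [Balaban1989LargeFieldII] Thm 1 for 𝐑 at representation level and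
(UV₉) = (0.1) ∕ Cor. 3 pointwise on the represented densities are displayed HYPOTHESES (what the paper proves, pp. 356–391 and p. 387); their objects (`Rstep`,
`Tstep`, `Laws`, `LawsT`, `eval`) are NODE 00 Stage ₉'s (seats node00-def ∕ def-R ∕ def-T), not yet of record — §§1–3 are generic over them; nothing of
Bałaban's asserted or proved here; one finite four-torus programme at fixed `ε`, Bałaban AS PRINTED with locators; nothing continuum ∕ ℝ⁴ ∕ OS ∕ mass gap ∕ Clay.
-/

noncomputable section

namespace Literature.MathematicalPhysics.QuantumFieldTheory.Balaban1983to89.B16NodeKnitRepTower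

open DagBinding T4Continuum Node00
open B16NodeKnitRecord5 (b16_main_of_rOperation_of_uvSlot)
open B16NodeKnitSocket (uvSlot_of_direct uvSlot_of_dominated)
open B14NodeKnitRepTower (b14_main_of_repTower densitiesDescribed_iff_laws sect2Form_iff_laws_of_eval)

/-! ## §1. World level, one run: N13 over a represented tower (NODE 00 Stage ₉ shape; T and R not hard-wired) -/

section World

variable (w : WorldP) (P : B12.RunParams) {Rep : ℕ → Type*} (rep : (k : ℕ) → Rep k)
  (Tstep : (k : ℕ) → Rep k → Rep (k + 1)) (Rstep : (k : ℕ) → Rep (k + 1) → Rep (k + 1))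
  (Laws : (k : ℕ) → Rep k → Prop) (LawsT : (k : ℕ) → Rep (k + 1) → Prop)

/-- **(R₉) ⇒ the laws are transported ALONG THE TOWER.**  If the 𝐑-step carries the corresponding space into the index-`(k+1)` laws at representation level
(`hR9 : ∀ r, LawsT k r → Laws (k+1) (Rstep k r)`, `k < K` — [Balaban1989LargeFieldII] Thm 1 for 𝐑 read on representations) and the tower obeys the recursion
`rep (k+1) = Rstep k (Tstep k (rep k))` ([Balaban1988Convergent] (0.2) at representation level), then along the tower `LawsT k (Tstep k (rep k)) → Laws (k+1)
(rep (k+1))`. Pure rewriting. [cite: Balaban1989LargeFieldII, Thm 1 p.355 with p.391; Balaban1988Convergent, (0.2) p.244] -/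
theorem lawsAlong_of_rstepLaw (hsucc : ∀ k, rep (k + 1) = Rstep k (Tstep k (rep k)))
    (hR9 : ∀ k, k < P.K → ∀ r : Rep (k + 1), LawsT k r → Laws (k + 1) (Rstep k r)) :
    ∀ k, k < P.K → LawsT k (Tstep k (rep k)) → Laws (k + 1) (rep (k + 1)) :=
  fun k hk h => by rw [hsucc]; exact hR9 k hk _ h

/-- **N13's 𝐑-product at a world over a represented tower.**  THE PIN READING (`hRpin`): the world's `rOperation` leaf ([Balaban1988Convergent] p. 244, bound as
`ROpLeaf V` at NODE 00's N-bindings) FOLLOWS from law transport along the tower — the along-the-tower pin of the 𝐑-carriers' spaces, §2 `rOpLeaf_of_lawsAlong`;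
(R₉) `hR9` + the recursion then inhabit the leaf.  HYPOTHESES displayed; count-neutral. [cite: Balaban1989LargeFieldII, Thm 1 p.355, p.391; Balaban1988Convergent, p.244] -/
theorem rOperation_of_repTower (hsucc : ∀ k, rep (k + 1) = Rstep k (Tstep k (rep k)))
    (hRpin : (∀ k, k < P.K → LawsT k (Tstep k (rep k)) → Laws (k + 1) (rep (k + 1))) → (w.up P).rOperation)
    (hR9 : ∀ k, k < P.K → ∀ r : Rep (k + 1), LawsT k r → Laws (k + 1) (Rstep k r)) :
    (leavesP w P).rOperation :=
  hRpin (lawsAlong_of_rstepLaw P rep Tstep Rstep Laws LawsT hsucc hR9)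

/-- **N13's Cor.-3 slot at a world over a represented tower, (UV₉) in `UVIneq` currency.**  If `w.γ ≤ γ₁` and, under the interval hypothesis on `]0, γ₁]`, every
LAW-ABIDING level `k ≤ K` (`Laws k (rep k)`) satisfies the pointwise two-sided bound `B16.UVIneq (w.C P) k U (w.em g_k) (w.ep g_k)` for every configuration `U`
([Balaban1989LargeFieldII] (0.1) pp. 355–356 *«with the constants E₋, E₊ independent of k, T_η, U_k»*; p. 387), and the run's §2-form clause at step `k` YIELDS
the laws of the carried representation (`hSL` — the Stage-₉ reading of `Sect2Form`), then «(interval ⇒ §2 description) ⇒ (interval ⇒ `uvBounds`)» holds at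
`(w, P)` (`B16NodeKnitSocket.uvSlot_of_direct`). [cite: Balaban1989LargeFieldII, (0.1) pp.355–356, p.387; Balaban1988Convergent, Cor. 3 (2.50) p.264] -/
theorem uvSlot_of_repTower (hSL : ∀ k, k ≤ P.K → (w.C P).Sect2Form k → Laws k (rep k)) {γ₁ : ℝ} (hγ : w.γ ≤ γ₁)
    (hUV9 : (w.C P).flow.InInterval γ₁ P.K → ∀ k, k ≤ P.K → Laws k (rep k) → ∀ U : (w.C P).Cfg k,
      B16.UVIneq (w.C P) k U (w.em ((w.C P).flow.g k)) (w.ep ((w.C P).flow.g k))) :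
    ((leavesP w P).smallCouplings → (leavesP w P).densitiesDescribed) →
      ((leavesP w P).smallCouplings → (leavesP w P).uvBounds) :=
  uvSlot_of_direct w P hγ fun hsc k hk hs U => hUV9 hsc k hk (hSL k hk hs) U

variable (eval : (k : ℕ) → Rep k → ((w.C P).Cfg k → ℝ))

/-- **(UV₉) in explicit-`eval` currency**: with the densities of record DEFINED as the represented functions, `ρ_k = eval rep_k` (`hρ`), the pointwise bound
stated ON THE EXPLICIT FUNCTION — `χ_k(U)·exp(−A_k(U)/g_k² − e₋(g_k)|T_η|) ≤ (eval rep_k)(U) ≤ exp(e₊(g_k)|T_η|)` for law-abiding levels — is the (0.1) face print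
states (no Radon–Nikodym version in sight), and yields N13's Cor.-3 slot. [cite: Balaban1989LargeFieldII, (0.1) pp.355–356, p.387; Balaban1988Convergent, (2.18) p.257] -/
theorem uvSlot_of_repTower_eval (hρ : ∀ k, (w.C P).ρ k = eval k (rep k)) (hSL : ∀ k, k ≤ P.K → (w.C P).Sect2Form k → Laws k (rep k))
    {γ₁ : ℝ} (hγ : w.γ ≤ γ₁)
    (hUV9 : (w.C P).flow.InInterval γ₁ P.K → ∀ k, k ≤ P.K → Laws k (rep k) → ∀ U : (w.C P).Cfg k,
      (w.C P).χ k U * Real.exp (-(1 / ((w.C P).flow.g k) ^ 2 * (w.C P).wilsonBG k U) - w.em ((w.C P).flow.g k) * ((w.C P).numSites k : ℝ))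
          ≤ eval k (rep k) U ∧
        eval k (rep k) U ≤ Real.exp (w.ep ((w.C P).flow.g k) * ((w.C P).numSites k : ℝ))) :
    ((leavesP w P).smallCouplings → (leavesP w P).densitiesDescribed) →
      ((leavesP w P).smallCouplings → (leavesP w P).uvBounds) := by
  refine uvSlot_of_repTower w P rep Laws hSL hγ fun hsc k hk hl U => ?_
  show _ ≤ (w.C P).ρ k U ∧ (w.C P).ρ k U ≤ _
  rw [hρ k]
  exact hUV9 hsc k hk hl U

/-- **(UV₉) from DOMINATED per-step constants** — the form in which the cell's Cor.-3 chain delivers explicit constants (`B16Cor3CurlyGas`: one run, one step,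
`E₋ ≤ e₋(g_k)`, `E₊ ≤ e₊(g_k)` with `UVIneq … E₋ E₊` pointwise) —, GIVEN the sign convention `χ_k ≥ 0` of the construction (`B16.uvIneq_of_le` through
`B16NodeKnitSocket.uvSlot_of_dominated`). [cite: Balaban1989LargeFieldII, (0.1) pp.355–356, p.387] -/
theorem uvSlot_of_repTower_dominated (hSL : ∀ k, k ≤ P.K → (w.C P).Sect2Form k → Laws k (rep k)) {γ₁ : ℝ} (hγ : w.γ ≤ γ₁)
    (hχ : ∀ k, k ≤ P.K → ∀ U : (w.C P).Cfg k, 0 ≤ (w.C P).χ k U)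
    (hUVd : (w.C P).flow.InInterval γ₁ P.K → ∀ k, k ≤ P.K → Laws k (rep k) →
      ∃ Em Ep : ℝ, Em ≤ w.em ((w.C P).flow.g k) ∧ Ep ≤ w.ep ((w.C P).flow.g k) ∧ ∀ U : (w.C P).Cfg k, B16.UVIneq (w.C P) k U Em Ep) :
    ((leavesP w P).smallCouplings → (leavesP w P).densitiesDescribed) →
      ((leavesP w P).smallCouplings → (leavesP w P).uvBounds) :=
  uvSlot_of_dominated w P hγ hχ fun hsc k hk hs => hUVd hsc k hk (hSL k hk hs)

/-- **N13 OVER A REPRESENTED TOWER** ([Balaban1989LargeFieldII] Thm 1 p. 355 + (0.1), Cor. 3 pp. 387 ∕ 391; NODE 00 Stage ₉ shape, pub-ymgap chair R437): `Dag.B16_main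
(leavesP w P)` from — (R₉) `hR9`: the 𝐑-step transports the corresponding space into the index-`(k+1)` laws at representation level, `k < K` (what [V] proves
for 𝐑); the recursion `hsucc` ([III] (0.2)); the PIN READING `hRpin` of the world's 𝐑-leaf (along-the-tower spaces, §2); the Stage-₉ reading `hSL` of the
§2-form clause; and (UV₉) `hUV9`: the pointwise (0.1) for law-abiding levels below the threshold `γ₁ ≥ w.γ` (what [V] p. 387 proves).  The nine in-edge
antecedents of the node are unused by the knit (they are consumed INSIDE (R₉)∕(UV₉) in print).  T and R NOT hard-wired. HYPOTHESES displayed; count-neutral.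
[cite: Balaban1989LargeFieldII, Thm 1 p.355, (0.1) pp.355–356, p.387, p.391; Balaban1988Convergent, p.244 and Cor. 3 p.264] -/
theorem b16_main_of_repTower (hsucc : ∀ k, rep (k + 1) = Rstep k (Tstep k (rep k)))
    (hRpin : (∀ k, k < P.K → LawsT k (Tstep k (rep k)) → Laws (k + 1) (rep (k + 1))) → (w.up P).rOperation)
    (hR9 : ∀ k, k < P.K → ∀ r : Rep (k + 1), LawsT k r → Laws (k + 1) (Rstep k r))
    (hSL : ∀ k, k ≤ P.K → (w.C P).Sect2Form k → Laws k (rep k)) {γ₁ : ℝ} (hγ : w.γ ≤ γ₁)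
    (hUV9 : (w.C P).flow.InInterval γ₁ P.K → ∀ k, k ≤ P.K → Laws k (rep k) → ∀ U : (w.C P).Cfg k,
      B16.UVIneq (w.C P) k U (w.em ((w.C P).flow.g k)) (w.ep ((w.C P).flow.g k))) :
    Dag.B16_main (leavesP w P) :=
  b16_main_of_rOperation_of_uvSlot w P (rOperation_of_repTower w P rep Tstep Rstep Laws LawsT hsucc hRpin hR9)
    (uvSlot_of_repTower w P rep Laws hSL hγ hUV9)

/-- The same with (R₉) asked only ALONG THE TOWER (`LawsT k (Tstep k (rep k)) → Laws (k+1) (rep (k+1))`; no `Rstep` named) — the weakest form the pin consumes.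
[cite: Balaban1989LargeFieldII, Thm 1 p.355, (0.1) pp.355–356, p.387, p.391] -/
theorem b16_main_of_repTower_along
    (hRpin : (∀ k, k < P.K → LawsT k (Tstep k (rep k)) → Laws (k + 1) (rep (k + 1))) → (w.up P).rOperation)
    (hRalong : ∀ k, k < P.K → LawsT k (Tstep k (rep k)) → Laws (k + 1) (rep (k + 1)))
    (hSL : ∀ k, k ≤ P.K → (w.C P).Sect2Form k → Laws k (rep k)) {γ₁ : ℝ} (hγ : w.γ ≤ γ₁)
    (hUV9 : (w.C P).flow.InInterval γ₁ P.K → ∀ k, k ≤ P.K → Laws k (rep k) → ∀ U : (w.C P).Cfg k,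
      B16.UVIneq (w.C P) k U (w.em ((w.C P).flow.g k)) (w.ep ((w.C P).flow.g k))) :
    Dag.B16_main (leavesP w P) :=
  b16_main_of_rOperation_of_uvSlot w P (hRpin hRalong) (uvSlot_of_repTower w P rep Laws hSL hγ hUV9)

/-- **N13 OVER A REPRESENTED TOWER UNDER THE STAGE-₉ READING OF THE DENSITIES** (`ρ_k = eval rep_k`, `Sect2Form k ↔ ρ_k = eval rep_k ∧ Laws rep_k` — the
hypotheses `hρ`, `hS9` of seat dag-n11-a's `B14NodeKnitRepTower.b14_main_of_repTower_eval`, shared verbatim), (UV₉) written on the explicit function `eval rep_k`.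
[cite: Balaban1989LargeFieldII, Thm 1 p.355, (0.1) pp.355–356, p.387, p.391; Balaban1988Convergent, (2.18) p.257] -/
theorem b16_main_of_repTower_eval (hsucc : ∀ k, rep (k + 1) = Rstep k (Tstep k (rep k)))
    (hρ : ∀ k, (w.C P).ρ k = eval k (rep k))
    (hS9 : ∀ k, k ≤ P.K → ((w.C P).Sect2Form k ↔ ((w.C P).ρ k = eval k (rep k) ∧ Laws k (rep k))))
    (hRpin : (∀ k, k < P.K → LawsT k (Tstep k (rep k)) → Laws (k + 1) (rep (k + 1))) → (w.up P).rOperation)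
    (hR9 : ∀ k, k < P.K → ∀ r : Rep (k + 1), LawsT k r → Laws (k + 1) (Rstep k r)) {γ₁ : ℝ} (hγ : w.γ ≤ γ₁)
    (hUV9 : (w.C P).flow.InInterval γ₁ P.K → ∀ k, k ≤ P.K → Laws k (rep k) → ∀ U : (w.C P).Cfg k,
      (w.C P).χ k U * Real.exp (-(1 / ((w.C P).flow.g k) ^ 2 * (w.C P).wilsonBG k U) - w.em ((w.C P).flow.g k) * ((w.C P).numSites k : ℝ))
          ≤ eval k (rep k) U ∧
        eval k (rep k) U ≤ Real.exp (w.ep ((w.C P).flow.g k) * ((w.C P).numSites k : ℝ))) :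
    Dag.B16_main (leavesP w P) :=
  b16_main_of_rOperation_of_uvSlot w P (rOperation_of_repTower w P rep Tstep Rstep Laws LawsT hsucc hRpin hR9)
    (uvSlot_of_repTower_eval w P rep Laws eval hρ (fun k hk h => ((hS9 k hk).1 h).2) hγ hUV9)

/-- **N13 over a represented tower from (R₉) and DOMINATED per-step (0.1) constants**, given `χ_k ≥ 0`. [cite: Balaban1989LargeFieldII, Thm 1 p.355, (0.1) pp.355–356, p.387] -/
theorem b16_main_of_repTower_dominated (hsucc : ∀ k, rep (k + 1) = Rstep k (Tstep k (rep k)))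
    (hRpin : (∀ k, k < P.K → LawsT k (Tstep k (rep k)) → Laws (k + 1) (rep (k + 1))) → (w.up P).rOperation)
    (hR9 : ∀ k, k < P.K → ∀ r : Rep (k + 1), LawsT k r → Laws (k + 1) (Rstep k r))
    (hSL : ∀ k, k ≤ P.K → (w.C P).Sect2Form k → Laws k (rep k)) {γ₁ : ℝ} (hγ : w.γ ≤ γ₁)
    (hχ : ∀ k, k ≤ P.K → ∀ U : (w.C P).Cfg k, 0 ≤ (w.C P).χ k U)
    (hUVd : (w.C P).flow.InInterval γ₁ P.K → ∀ k, k ≤ P.K → Laws k (rep k) →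
      ∃ Em Ep : ℝ, Em ≤ w.em ((w.C P).flow.g k) ∧ Ep ≤ w.ep ((w.C P).flow.g k) ∧ ∀ U : (w.C P).Cfg k, B16.UVIneq (w.C P) k U Em Ep) :
    Dag.B16_main (leavesP w P) :=
  b16_main_of_rOperation_of_uvSlot w P (rOperation_of_repTower w P rep Tstep Rstep Laws LawsT hsucc hRpin hR9)
    (uvSlot_of_repTower_dominated w P rep Laws hSL hγ hχ hUVd)

/-- **What N13's 𝐑-product SAYS at Stage ₉** (located, for the planner's `stub_N13` text and the vacuity audit A4): if the world's 𝐑-leaf READS AS law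
transport along the tower (`hRiff`, both directions — §2 `rOpLeaf_iff_lawsAlong` under the along-pins), then N13 at `(w, P)` together with its eight in-edge
leaves and the small-field implication YIELDS `LawsT k (Tstep k (rep k)) → Laws (k+1) (rep (k+1))` for every `k < K`: the content is law transport, empty
exactly when the target laws are. [cite: Balaban1989LargeFieldII, Thm 1 p.355 (bookkeeping); Balaban1988Convergent, p.244] -/
theorem lawsAlong_of_b16_main
    (hRiff : (w.up P).rOperation ↔ ∀ k, k < P.K → LawsT k (Tstep k (rep k)) → Laws (k + 1) (rep (k + 1)))
    (h : Dag.B16_main (leavesP w P))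
    (h5 : (leavesP w P).b5) (h6 : (leavesP w P).b6) (h7 : (leavesP w P).b7) (h9 : (leavesP w P).b9) (h10 : (leavesP w P).b10)
    (h11 : (leavesP w P).b11) (h13 : (leavesP w P).b13) (hrb : (leavesP w P).rBasicStep)
    (hsf : (leavesP w P).smallCouplings → (leavesP w P).smallFieldInductive) :
    ∀ k, k < P.K → LawsT k (Tstep k (rep k)) → Laws (k + 1) (rep (k + 1)) :=
  hRiff.1 (h h5 h6 h7 h9 h10 h11 h13 hrb hsf).1

/-- **What N13's Cor.-3 product SAYS at Stage ₉** (located; A4): under the Stage-₉ reading (`ρ_k = eval rep_k`, `Sect2Form k ↔ ρ_k = eval rep_k ∧ Laws rep_k`),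
N13 at `(w, P)` with its in-edge leaves, the interval hypothesis on `]0, w.γ]` and law-abiding levels `∀ k ≤ K, Laws k (rep k)` YIELDS the two-sided bound (0.1)
POINTWISE ON THE EXPLICIT FUNCTIONS `eval rep_k`, every `k ≤ K`, every configuration. [cite: Balaban1989LargeFieldII, (0.1) pp.355–356 (bookkeeping); Balaban1988Convergent, (2.18) p.257] -/
theorem uvIneq_eval_of_b16_main (hρ : ∀ k, (w.C P).ρ k = eval k (rep k))
    (hS9 : ∀ k, k ≤ P.K → ((w.C P).Sect2Form k ↔ ((w.C P).ρ k = eval k (rep k) ∧ Laws k (rep k))))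
    (h : Dag.B16_main (leavesP w P))
    (h5 : (leavesP w P).b5) (h6 : (leavesP w P).b6) (h7 : (leavesP w P).b7) (h9 : (leavesP w P).b9) (h10 : (leavesP w P).b10)
    (h11 : (leavesP w P).b11) (h13 : (leavesP w P).b13) (hrb : (leavesP w P).rBasicStep)
    (hsf : (leavesP w P).smallCouplings → (leavesP w P).smallFieldInductive)
    (hsc : (leavesP w P).smallCouplings) (hlaws : ∀ k, k ≤ P.K → Laws k (rep k)) (k : ℕ) (hk : k ≤ P.K) (U : (w.C P).Cfg k) :
    (w.C P).χ k U * Real.exp (-(1 / ((w.C P).flow.g k) ^ 2 * (w.C P).wilsonBG k U) - w.em ((w.C P).flow.g k) * ((w.C P).numSites k : ℝ))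
        ≤ eval k (rep k) U ∧
      eval k (rep k) U ≤ Real.exp (w.ep ((w.C P).flow.g k) * ((w.C P).numSites k : ℝ)) := by
  have hdd : (leavesP w P).smallCouplings → (leavesP w P).densitiesDescribed :=
    fun _ => (densitiesDescribed_iff_laws w P rep Laws eval hρ hS9).2 hlaws
  have huv := (h h5 h6 h7 h9 h10 h11 h13 hrb hsf).2 hdd hsc k hk U
  rw [← hρ k]
  exact huv

end World

/-! ## §2. Density level: the 𝐑-carriers `V : PrintedCarriers14R` pinned ALONG THE TOWER — `ROpLeaf V` ↔ law transport -/

section Carriers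

variable (V : PrintedCarriers14R) {Rep : ℕ → Type*} (rep : (k : ℕ) → Rep k) (rT : (k : ℕ) → Rep (k + 1))
  (Laws : (k : ℕ) → Rep k → Prop) (LawsT : (k : ℕ) → Rep (k + 1) → Prop)
  (evalD : (k : ℕ) → Rep k → Density V.P k V.G)

/-- **THE ALONG-THE-TOWER PIN OF THE 𝐑-CARRIERS, read back** ([Balaban1988Convergent] p. 244 *«we will only assume that it has some properties incorporated in the
inductive description»*; p. 262: 𝐑T carries the index-`k` space into the index-`(k+1)` space).  Suppose the carriers' spaces are pinned on the run's own tower —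
`V.Scorr (k+1) ρ' ↔ ρ' = eval rT_k ∧ LawsT k rT_k` (the corresponding space: the record's represented `Tρ_k` with its laws; `rT_k` the T-image representation,
e.g. `Tstep k (rep k)`), `V.S (k+1) ρ ↔ ρ = eval rep_{k+1} ∧ Laws (k+1) rep_{k+1}` (NODE 00's `S218` at ₉: `ρ = eval rep ∧ Laws rep`), and the density operator
returns the record's `ρ_{k+1}` on the record's `Tρ_k` (`hRT : V.R k (eval rT_k) = eval rep_{k+1}` — the operator INDUCED by `Rstep`, [Balaban1989LargeFieldI] (0.3)
p. 176).  Then the bound leaf `ROpLeaf V` IS law transport along the tower: `∀ k < K, LawsT k rT_k → Laws (k+1) rep_{k+1}`.  (The pin NODE 00's `Record9` can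
instantiate by `Iff.rfl` ∕ `rfl`; kernel form of `STAGE6-9-DESIGN-g28.md` §2 for the 𝐑-leaf.) [cite: Balaban1988Convergent, p.244 and remark p.262; Balaban1989LargeFieldI, (0.2)–(0.3) p.176] -/
theorem rOpLeaf_iff_lawsAlong
    (hScorr : ∀ k, k < V.K → ∀ ρ' : Density V.P (k + 1) V.G, V.Scorr (k + 1) ρ' ↔ (ρ' = evalD (k + 1) (rT k) ∧ LawsT k (rT k)))
    (hS : ∀ k, k < V.K → ∀ ρ : Density V.P (k + 1) V.G, V.S (k + 1) ρ ↔ (ρ = evalD (k + 1) (rep (k + 1)) ∧ Laws (k + 1) (rep (k + 1))))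
    (hRT : ∀ k, k < V.K → V.R k (evalD (k + 1) (rT k)) = evalD (k + 1) (rep (k + 1))) :
    ROpLeaf V ↔ ∀ k, k < V.K → LawsT k (rT k) → Laws (k + 1) (rep (k + 1)) := by
  rw [rOpLeaf_iff]
  refine ⟨fun h k hk hT => ?_, fun h k hk ρ' hρ' => ?_⟩
  · have hS' := h k hk (evalD (k + 1) (rT k)) ((hScorr k hk _).2 ⟨rfl, hT⟩)
    rw [hRT k hk] at hS'
    exact ((hS k hk _).1 hS').2
  · obtain ⟨hρ'eq, hT⟩ := (hScorr k hk ρ').1 hρ'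
    subst hρ'eq
    rw [hRT k hk]
    exact (hS k hk _).2 ⟨rfl, h k hk hT⟩

/-- **One-directional pins suffice to PRODUCE the leaf**: if membership in the corresponding space IDENTIFIES the record's `Tρ_k` with its laws (`hScorr`, → only),
the index-`(k+1)` space ACCEPTS the record's `ρ_{k+1}` once its laws hold (`hS`, ← only), and `V.R` returns `ρ_{k+1}` on `Tρ_k`, then law transport along the
tower inhabits `ROpLeaf V`. [cite: Balaban1988Convergent, p.244; Balaban1989LargeFieldI, (0.3) p.176] -/
theorem rOpLeaf_of_lawsAlong
    (hScorr : ∀ k, k < V.K → ∀ ρ' : Density V.P (k + 1) V.G, V.Scorr (k + 1) ρ' → (ρ' = evalD (k + 1) (rT k) ∧ LawsT k (rT k)))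
    (hS : ∀ k, k < V.K → ∀ ρ : Density V.P (k + 1) V.G, ρ = evalD (k + 1) (rep (k + 1)) → Laws (k + 1) (rep (k + 1)) → V.S (k + 1) ρ)
    (hRT : ∀ k, k < V.K → V.R k (evalD (k + 1) (rT k)) = evalD (k + 1) (rep (k + 1)))
    (h : ∀ k, k < V.K → LawsT k (rT k) → Laws (k + 1) (rep (k + 1))) : ROpLeaf V := by
  rw [rOpLeaf_iff]
  intro k hk ρ' hρ'
  obtain ⟨hρ'eq, hT⟩ := hScorr k hk ρ' hρ'
  subst hρ'eq
  exact hS k hk _ (hRT k hk) (h k hk hT)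

variable (Tstep : (k : ℕ) → Rep k → Rep (k + 1)) (Rstep : (k : ℕ) → Rep (k + 1) → Rep (k + 1))

/-- **`ROpLeaf V` from (R₉)** — [Balaban1989LargeFieldII] Thm 1 for 𝐑 at representation level (`∀ r, LawsT k r → Laws (k+1) (Rstep k r)`) — over a tower with
`rep (k+1) = Rstep k (Tstep k (rep k))` whose 𝐑-carriers are pinned along it (T-image `rT_k := Tstep k (rep k)`).  This is the ₉-currency producer of the leaf
[Balaban1988Convergent] p. 244 assumes and N11 consumes. [cite: Balaban1989LargeFieldII, Thm 1 p.355, p.391; Balaban1988Convergent, p.244; Balaban1989LargeFieldI, (0.3) p.176] -/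
theorem rOpLeaf_of_rstepLaw (hsucc : ∀ k, rep (k + 1) = Rstep k (Tstep k (rep k)))
    (hScorr : ∀ k, k < V.K → ∀ ρ' : Density V.P (k + 1) V.G,
      V.Scorr (k + 1) ρ' → (ρ' = evalD (k + 1) (Tstep k (rep k)) ∧ LawsT k (Tstep k (rep k))))
    (hS : ∀ k, k < V.K → ∀ ρ : Density V.P (k + 1) V.G, ρ = evalD (k + 1) (rep (k + 1)) → Laws (k + 1) (rep (k + 1)) → V.S (k + 1) ρ)
    (hRT : ∀ k, k < V.K → V.R k (evalD (k + 1) (Tstep k (rep k))) = evalD (k + 1) (rep (k + 1)))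
    (hR9 : ∀ k, k < V.K → ∀ r : Rep (k + 1), LawsT k r → Laws (k + 1) (Rstep k r)) : ROpLeaf V :=
  rOpLeaf_of_lawsAlong V rep (fun k => Tstep k (rep k)) Laws LawsT evalD hScorr hS hRT
    fun k hk h => by rw [hsucc]; exact hR9 k hk _ h

/-- **Vacuity audit A4 for the 𝐑-leaf at Stage ₉ (kernel form).**  Under along-pins the leaf has content ONLY through the laws of the TARGET space: if the
index-`(k+1)` laws of the record's own `rep (k+1)` hold outright (`hlaws` — in particular for a LAW-FREE pin `S (k+1) ρ :↔ ρ = eval rep_{k+1}`), `ROpLeaf V` is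
inhabited whatever the 𝐑-step does.  Hence NODE 00's `S218` at ₉ must carry the inductive «conditions and bounds» of [Balaban1988Convergent] §2 as laws (seat
dag-n11-a's pointer [DAGN11A-G3-POINTER-LAWS]) for N13's 𝐑-product to say anything. [cite: Balaban1988Convergent, p.244 and Thm 1 p.262 (bookkeeping)] -/
theorem rOpLeaf_of_targetLaws
    (hScorr : ∀ k, k < V.K → ∀ ρ' : Density V.P (k + 1) V.G, V.Scorr (k + 1) ρ' → (ρ' = evalD (k + 1) (rT k) ∧ LawsT k (rT k)))
    (hS : ∀ k, k < V.K → ∀ ρ : Density V.P (k + 1) V.G, ρ = evalD (k + 1) (rep (k + 1)) → Laws (k + 1) (rep (k + 1)) → V.S (k + 1) ρ)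
    (hRT : ∀ k, k < V.K → V.R k (evalD (k + 1) (rT k)) = evalD (k + 1) (rep (k + 1)))
    (hlaws : ∀ k, k < V.K → Laws (k + 1) (rep (k + 1))) : ROpLeaf V :=
  rOpLeaf_of_lawsAlong V rep rT Laws LawsT evalD hScorr hS hRT fun k hk _ => hlaws k hk

end Carriers

/-! ## §3. Junction with N11 on ONE represented tower, BY NAME — up to the run's (B) and the pin `B16.EndStatementBPrinted w.C` -/

section Junction

variable (w : WorldP) (P : B12.RunParams) {Rep : ℕ → Type*} (rep : (k : ℕ) → Rep k)
  (Tstep : (k : ℕ) → Rep k → Rep (k + 1)) (Rstep : (k : ℕ) → Rep (k + 1) → Rep (k + 1))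
  (Laws : (k : ℕ) → Rep k → Prop) (LawsT : (k : ℕ) → Rep (k + 1) → Prop) (eval : (k : ℕ) → Rep k → ((w.C P).Cfg k → ℝ))

/-- **N11 ∧ N13 ON ONE REPRESENTED TOWER, BY NAME** (seat dag-n11-a's `B14NodeKnitRepTower.b14_main_of_repTower_eval` + `b16_main_of_repTower_eval`): under the
Stage-₉ reading of the densities, from (S0) the start representation obeys the laws, (S1) THE THEOREM OF [Balaban1988Convergent] p. 245 AT REPRESENTATION LEVEL
(`Tstep` carries law-abiding representations into the corresponding space, given N11's antecedents), (R₉) [Balaban1989LargeFieldII] Thm 1 for 𝐑 at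
representation level — which DISCHARGES N11's (𝐑) hypothesis outright —, the pin reading of the world's 𝐑-leaf, and (UV₉) the pointwise (0.1) on `eval rep_k`.
[cite: Balaban1988Convergent, Thm 1 p.262, Theorem p.245, p.244; Balaban1989LargeFieldII, Thm 1 p.355, (0.1) pp.355–356, p.387, p.391] -/
theorem nodes_N11_N13_of_repTower (hsucc : ∀ k, rep (k + 1) = Rstep k (Tstep k (rep k)))
    (hρ : ∀ k, (w.C P).ρ k = eval k (rep k))
    (hS9 : ∀ k, k ≤ P.K → ((w.C P).Sect2Form k ↔ ((w.C P).ρ k = eval k (rep k) ∧ Laws k (rep k))))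
    (h0 : (leavesP w P).smallCouplings → Laws 0 (rep 0))
    (hT : (leavesP w P).b7 → (leavesP w P).b8 → (leavesP w P).b9 → (leavesP w P).b10 → (leavesP w P).b11 →
      (leavesP w P).smallCouplings → (leavesP w P).smallFieldInductive → (leavesP w P).flowControl →
        ∀ k, k < P.K → Laws k (rep k) → LawsT k (Tstep k (rep k)))
    (hRpin : (∀ k, k < P.K → LawsT k (Tstep k (rep k)) → Laws (k + 1) (rep (k + 1))) → (w.up P).rOperation)
    (hR9 : ∀ k, k < P.K → ∀ r : Rep (k + 1), LawsT k r → Laws (k + 1) (Rstep k r)) {γ₁ : ℝ} (hγ : w.γ ≤ γ₁)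
    (hUV9 : (w.C P).flow.InInterval γ₁ P.K → ∀ k, k ≤ P.K → Laws k (rep k) → ∀ U : (w.C P).Cfg k,
      (w.C P).χ k U * Real.exp (-(1 / ((w.C P).flow.g k) ^ 2 * (w.C P).wilsonBG k U) - w.em ((w.C P).flow.g k) * ((w.C P).numSites k : ℝ))
          ≤ eval k (rep k) U ∧
        eval k (rep k) U ≤ Real.exp (w.ep ((w.C P).flow.g k) * ((w.C P).numSites k : ℝ))) :
    Dag.B14_main (leavesP w P) ∧ Dag.B16_main (leavesP w P) :=
  ⟨B14NodeKnitRepTower.b14_main_of_repTower_eval w P rep Tstep Rstep Laws LawsT eval hsucc hρ hS9 h0 hT fun _ => hR9,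
    b16_main_of_repTower_eval w P rep Tstep Rstep Laws LawsT eval hsucc hρ hS9 hRpin hR9 hγ hUV9⟩

/-- **The run's (B) `Dag.UVStability4D (leavesP w P)`** («interval ⇒ §2 description ∧ (0.1)») over a represented tower: the two knits' slots as in
`nodes_N11_N13_of_repTower`, GIVEN — as hypotheses — N11's in-edge leaves `b7 … b11` (products of N04–N08), the small-field leaf «interval ⇒ inductive
assumptions» (N09∕N10) and the located flow step «interval ⇒ (2.6)» (`Dag.FlowStepPrinted`, β-side).  Pure composition of `Dag.B14_main` and `Dag.B16_main`.
[cite: Balaban1989LargeFieldII, Thm 1 + (0.1) p.355; Balaban1988Convergent, Thm 1 p.262] -/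
theorem uvStability4D_of_repTower (hsucc : ∀ k, rep (k + 1) = Rstep k (Tstep k (rep k)))
    (hρ : ∀ k, (w.C P).ρ k = eval k (rep k))
    (hS9 : ∀ k, k ≤ P.K → ((w.C P).Sect2Form k ↔ ((w.C P).ρ k = eval k (rep k) ∧ Laws k (rep k))))
    (h0 : (leavesP w P).smallCouplings → Laws 0 (rep 0))
    (hT : (leavesP w P).b7 → (leavesP w P).b8 → (leavesP w P).b9 → (leavesP w P).b10 → (leavesP w P).b11 →
      (leavesP w P).smallCouplings → (leavesP w P).smallFieldInductive → (leavesP w P).flowControl →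
        ∀ k, k < P.K → Laws k (rep k) → LawsT k (Tstep k (rep k)))
    (hRpin : (∀ k, k < P.K → LawsT k (Tstep k (rep k)) → Laws (k + 1) (rep (k + 1))) → (w.up P).rOperation)
    (hR9 : ∀ k, k < P.K → ∀ r : Rep (k + 1), LawsT k r → Laws (k + 1) (Rstep k r)) {γ₁ : ℝ} (hγ : w.γ ≤ γ₁)
    (hUV9 : (w.C P).flow.InInterval γ₁ P.K → ∀ k, k ≤ P.K → Laws k (rep k) → ∀ U : (w.C P).Cfg k,
      (w.C P).χ k U * Real.exp (-(1 / ((w.C P).flow.g k) ^ 2 * (w.C P).wilsonBG k U) - w.em ((w.C P).flow.g k) * ((w.C P).numSites k : ℝ))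
          ≤ eval k (rep k) U ∧
        eval k (rep k) U ≤ Real.exp (w.ep ((w.C P).flow.g k) * ((w.C P).numSites k : ℝ)))
    (h5 : (leavesP w P).b5) (h6 : (leavesP w P).b6) (h7 : (leavesP w P).b7) (h8 : (leavesP w P).b8) (h9 : (leavesP w P).b9)
    (h10 : (leavesP w P).b10) (h11 : (leavesP w P).b11) (h13 : (leavesP w P).b13) (hrb : (leavesP w P).rBasicStep)
    (hsf : (leavesP w P).smallCouplings → (leavesP w P).smallFieldInductive)
    (hfc : (leavesP w P).smallCouplings → (leavesP w P).flowControl) :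
    Dag.UVStability4D (leavesP w P) := by
  obtain ⟨h14, h16⟩ := nodes_N11_N13_of_repTower w P rep Tstep Rstep Laws LawsT eval hsucc hρ hS9 h0 hT hRpin hR9 hγ hUV9
  obtain ⟨hrop, huv⟩ := h16 h5 h6 h7 h9 h10 h11 h13 hrb hsf
  have hdd : (leavesP w P).smallCouplings → (leavesP w P).densitiesDescribed := h14 h7 h8 h9 h10 h11 hsf hfc hrop
  exact fun hsc => ⟨hdd hsc, huv hdd hsc⟩

end Junction

section Pin

variable (w : WorldP) {Rep : B12.RunParams → ℕ → Type*} (rep : (P : B12.RunParams) → (k : ℕ) → Rep P k)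
  (Tstep : (P : B12.RunParams) → (k : ℕ) → Rep P k → Rep P (k + 1)) (Rstep : (P : B12.RunParams) → (k : ℕ) → Rep P (k + 1) → Rep P (k + 1))
  (Laws : (P : B12.RunParams) → (k : ℕ) → Rep P k → Prop) (LawsT : (P : B12.RunParams) → (k : ℕ) → Rep P (k + 1) → Prop)
  (eval : (P : B12.RunParams) → (k : ℕ) → Rep P k → ((w.C P).Cfg k → ℝ))

/-- **[Balaban1989LargeFieldII] Thm 1 ∧ [III] Cor. 3 — the PIN `B16.EndStatementBPrinted w.C` (binder B2) — at a binding world carrying ONE REPRESENTED TOWER PER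
RUN**, with the world's `γ > 0`, `em`, `ep` as the witnesses (`DagBinding.endStatementBPrinted_of_worldsP`): per run the Stage-₉ reading, (S0), (S1), (R₉), the pin
reading, (UV₉) below `w.γ` itself, and N11's in-edge ∕ small-field ∕ flow-step leaves.  (Over a record this is binder B2's job — seat dag-n24-a's glue —; the
world-level form is recorded so that the ₉ slots are seen to close (B) with nothing else on the §2 ∕ (0.1) side.)
[cite: Balaban1989LargeFieldII, Thm 1 p.355 + p.391; Balaban1988Convergent, Cor. 3 (2.50) p.264] -/
theorem endStatementBPrinted_of_repTowers (hγ : 0 < w.γ)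
    (hsucc : ∀ P k, rep P (k + 1) = Rstep P k (Tstep P k (rep P k)))
    (hρ : ∀ P k, (w.C P).ρ k = eval P k (rep P k))
    (hS9 : ∀ P k, k ≤ P.K → ((w.C P).Sect2Form k ↔ ((w.C P).ρ k = eval P k (rep P k) ∧ Laws P k (rep P k))))
    (h0 : ∀ P, (leavesP w P).smallCouplings → Laws P 0 (rep P 0))
    (hT : ∀ P, (leavesP w P).b7 → (leavesP w P).b8 → (leavesP w P).b9 → (leavesP w P).b10 → (leavesP w P).b11 →
      (leavesP w P).smallCouplings → (leavesP w P).smallFieldInductive → (leavesP w P).flowControl →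
        ∀ k, k < P.K → Laws P k (rep P k) → LawsT P k (Tstep P k (rep P k)))
    (hRpin : ∀ P, (∀ k, k < P.K → LawsT P k (Tstep P k (rep P k)) → Laws P (k + 1) (rep P (k + 1))) → (w.up P).rOperation)
    (hR9 : ∀ P k, k < P.K → ∀ r : Rep P (k + 1), LawsT P k r → Laws P (k + 1) (Rstep P k r))
    (hUV9 : ∀ P, (w.C P).flow.InInterval w.γ P.K → ∀ k, k ≤ P.K → Laws P k (rep P k) → ∀ U : (w.C P).Cfg k,
      (w.C P).χ k U * Real.exp (-(1 / ((w.C P).flow.g k) ^ 2 * (w.C P).wilsonBG k U) - w.em ((w.C P).flow.g k) * ((w.C P).numSites k : ℝ))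
          ≤ eval P k (rep P k) U ∧
        eval P k (rep P k) U ≤ Real.exp (w.ep ((w.C P).flow.g k) * ((w.C P).numSites k : ℝ)))
    (h5 : ∀ P, (leavesP w P).b5) (h6 : ∀ P, (leavesP w P).b6) (h7 : ∀ P, (leavesP w P).b7) (h8 : ∀ P, (leavesP w P).b8)
    (h9 : ∀ P, (leavesP w P).b9) (h10 : ∀ P, (leavesP w P).b10) (h11 : ∀ P, (leavesP w P).b11) (h13 : ∀ P, (leavesP w P).b13)
    (hrb : ∀ P, (leavesP w P).rBasicStep)
    (hsf : ∀ P, (leavesP w P).smallCouplings → (leavesP w P).smallFieldInductive)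
    (hfc : ∀ P, (leavesP w P).smallCouplings → (leavesP w P).flowControl) :
    B16.EndStatementBPrinted w.C :=
  endStatementBPrinted_of_worldsP w hγ fun P =>
    uvStability4D_of_repTower w P (rep P) (Tstep P) (Rstep P) (Laws P) (LawsT P) (eval P) (hsucc P) (hρ P) (hS9 P) (h0 P) (hT P)
      (hRpin P) (hR9 P) le_rfl (hUV9 P) (h5 P) (h6 P) (h7 P) (h8 P) (h9 P) (h10 P) (h11 P) (h13 P) (hrb P) (hsf P) (hfc P)

end Pin

end Literature.MathematicalPhysics.QuantumFieldTheory.Balaban1983to89.B16NodeKnitRepTower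

end
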